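import Literature.Analysis.FluidPDE.NSSliceTimeBumps
import HarnessLib

/-!
# Extension of uniformly Cauchy slices to a jointly continuous function, and a.e. bookkeeping

Support file for the discharge of `Literature.Analysis.FluidPDE.NSSliceTimeContinuity`
(`FluidPDE/NSBoundedInteriorRegularity`); pure topology / measure theory.

* `subset_closure_of_ae_restrict_mem` — a set of full measure in an open subset of `ℝ` is dense
  in it;
* `exists_continuousOn_of_uniformly_cauchy_slices` — **the limit construction**: a family of
  slices `v t : X → F` (`F` complete), continuous on an open `O` for `t` in a set `T` dense in an
  open `I ⊆ ℝ`, which is uniformly Cauchy in `t` locally (`‖v t y - v s y‖ < ε` for `t, s ∈ T`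
  close to any `τ ∈ I`, uniformly in `y ∈ O`), extends to a function `W` continuous on `I × O`
  with `W(t, ·) = v t` on `O` for `t ∈ T` (`W(τ, y) = lim_{T ∋ s → τ} v s y`);
* `uniformly_cauchy_of_modulus` — the uniform Cauchy property from a bound
  `‖v t y - v s y‖ ≤ ω n + A n |P t - P s|` with `ω n → 0` and `P` continuous;
* `ae_eq_restrict_prod_of_ae_ae` — two a.e.-strongly measurable functions on a product
  `I × O ⊆ ℝ × Y` which agree slice-wise a.e. agree a.e.

Folklore.
-/

noncomputable section

open MeasureTheory Set Function Filter Topology TopologicalSpace Metric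
open scoped NNReal ENNReal

namespace Literature.Analysis.FluidPDE

/-! ### Full-measure subsets of open sets of `ℝ` are dense -/

/-- A subset of an open set `I ⊆ ℝ` which has full Lebesgue measure in `I` is dense in `I`.
[folklore] -/
theorem subset_closure_of_ae_restrict_mem {I S : Set ℝ} (hI : IsOpen I)
    (h : ∀ᵐ t ∂(volume.restrict I), t ∈ S) : I ⊆ closure S := by
  intro τ hτ
  rw [mem_closure_iff_nhds]
  intro U hU
  by_contra hne
  rw [not_nonempty_iff_eq_empty] at hne
  obtain ⟨V, hVU, hVo, hτV⟩ := _root_.mem_nhds_iff.1 hU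
  have hnull : volume ({t | t ∉ S} ∩ I) = 0 := by
    rw [← Measure.restrict_apply' hI.measurableSet]
    exact ae_iff.1 h
  have hpos : 0 < volume (V ∩ I) := (hVo.inter hI).measure_pos volume ⟨τ, hτV, hτ⟩
  have hsub : V ∩ I ⊆ {t | t ∉ S} ∩ I := by
    rintro t ⟨htV, htI⟩
    refine ⟨fun htS => ?_, htI⟩
    have : t ∈ U ∩ S := ⟨hVU htV, htS⟩
    rw [hne] at this
    exact this
  exact hpos.ne' (measure_mono_null hsub hnull)

/-! ### The limit construction -/

section Limit

variable {X : Type*} [TopologicalSpace X] {F : Type*} [NormedAddCommGroup F] [CompleteSpace F]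

/-- **Uniformly Cauchy slices extend continuously.** Let `I ⊆ ℝ` be open, `T ⊆ I` with
`I ⊆ closure T`, `O ⊆ X`, and `v t : X → F` continuous on `O` for `t ∈ T`. Suppose that for
every `τ ∈ I` and `ε > 0` there is a neighbourhood `V` of `τ` with `‖v t y - v s y‖ < ε` for all
`t, s ∈ V ∩ T` and `y ∈ O`. Then there is `W : ℝ × X → F`, continuous on `I × O`, with
`W(t, y) = v t y` for `t ∈ T`, `y ∈ O` (`W(τ, y)` is the limit of `v s y` as `T ∋ s → τ`, which
exists by completeness). [folklore] -/
theorem exists_continuousOn_of_uniformly_cauchy_slices {I T : Set ℝ} (hTI : T ⊆ I)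
    (hcl : I ⊆ closure T) {O : Set X} {v : ℝ → X → F}
    (hv : ∀ t ∈ T, ContinuousOn (v t) O)
    (hosc : ∀ τ ∈ I, ∀ ε > (0 : ℝ), ∃ V ∈ 𝓝 τ, ∀ t ∈ V ∩ T, ∀ s ∈ V ∩ T, ∀ y ∈ O,
      ‖v t y - v s y‖ < ε) :
    ∃ W : ℝ × X → F, ContinuousOn W (I ×ˢ O) ∧ ∀ t ∈ T, ∀ y ∈ O, W (t, y) = v t y := by
  classical
  have hne : ∀ τ ∈ I, (𝓝[T] τ).NeBot := fun τ hτ =>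
    mem_closure_iff_nhdsWithin_neBot.1 (hcl hτ)
  -- Step 1: the limits exist
  have hlim : ∀ τ ∈ I, ∀ y ∈ O, ∃ c : F, Tendsto (fun s => v s y) (𝓝[T] τ) (𝓝 c) := by
    intro τ hτ y hy
    haveI := hne τ hτ
    have hC : Cauchy (map (fun s => v s y) (𝓝[T] τ)) := by
      refine Metric.cauchy_iff.2 ⟨inferInstance, fun ε hε => ?_⟩
      obtain ⟨V, hV, hVb⟩ := hosc τ hτ ε hε
      refine ⟨(fun s => v s y) '' (V ∩ T), image_mem_map ?_, ?_⟩
      · rw [inter_comm]; exact inter_mem_nhdsWithin T hV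
      · rintro _ ⟨t, ht, rfl⟩ _ ⟨s, hs, rfl⟩
        rw [dist_eq_norm]
        exact hVb t ht s hs y hy
    obtain ⟨c, hc⟩ := CompleteSpace.complete hC
    exact ⟨c, hc⟩
  -- the limit function
  set W : ℝ × X → F := fun q => limUnder (𝓝[T] q.1) (fun s => v s q.2) with hW_def
  have hW : ∀ τ ∈ I, ∀ y ∈ O, Tendsto (fun s => v s y) (𝓝[T] τ) (𝓝 (W (τ, y))) :=
    fun τ hτ y hy => tendsto_nhds_limUnder (hlim τ hτ y hy)
  -- Step 2: on `T`, `W` is `v`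
  have hWT : ∀ t ∈ T, ∀ y ∈ O, W (t, y) = v t y := by
    intro t ht y hy
    haveI := hne t (hTI ht)
    refine tendsto_nhds_unique (hW t (hTI ht) y hy) ?_
    rw [Metric.tendsto_nhds]
    intro ε hε
    obtain ⟨V, hV, hVb⟩ := hosc t (hTI ht) ε hε
    have hmem : V ∩ T ∈ 𝓝[T] t := by rw [inter_comm]; exact inter_mem_nhdsWithin T hV
    filter_upwards [hmem] with s hs
    rw [dist_eq_norm]
    exact hVb s hs t ⟨mem_of_mem_nhds hV, ht⟩ y hy
  -- Step 3: the limit is `ε/4`-close to the slices at nearby good times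
  have hclose : ∀ τ ∈ I, ∀ ε > (0 : ℝ), ∃ V : Set ℝ, IsOpen V ∧ τ ∈ V ∧
      ∀ τ' ∈ V ∩ I, ∀ s ∈ V ∩ T, ∀ y ∈ O, ‖W (τ', y) - v s y‖ ≤ ε := by
    intro τ hτ ε hε
    obtain ⟨V₀, hV₀, hVb⟩ := hosc τ hτ ε hε
    obtain ⟨V, hVV₀, hVo, hτV⟩ := _root_.mem_nhds_iff.1 hV₀
    refine ⟨V, hVo, hτV, fun τ' hτ' s hs y hy => ?_⟩
    haveI := hne τ' hτ'.2
    have h1 : Tendsto (fun t => ‖v t y - v s y‖) (𝓝[T] τ') (𝓝 ‖W (τ', y) - v s y‖) :=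
      ((hW τ' hτ'.2 y hy).sub tendsto_const_nhds).norm
    refine le_of_tendsto h1 ?_
    have hmem : V ∩ T ∈ 𝓝[T] τ' := by
      rw [inter_comm]; exact inter_mem_nhdsWithin T (hVo.mem_nhds hτ'.1)
    filter_upwards [hmem] with t ht
    exact (hVb t ⟨hVV₀ ht.1, ht.2⟩ s ⟨hVV₀ hs.1, hs.2⟩ y hy).le
  refine ⟨W, ?_, hWT⟩
  -- Step 4: continuity on `I × O`
  rintro ⟨τ, y⟩ ⟨hτ, hy⟩
  rw [ContinuousWithinAt, Metric.tendsto_nhds]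
  intro ε hε
  obtain ⟨V, hVo, hτV, hVb⟩ := hclose τ hτ (ε / 4) (by positivity)
  -- a good time `s ∈ V ∩ T`
  obtain ⟨s, hsV, hsT⟩ : (V ∩ T).Nonempty :=
    mem_closure_iff_nhds.1 (hcl hτ) V (hVo.mem_nhds hτV)
  -- spatial continuity of the good slice at `y`
  have hsc : ∀ᶠ y' in 𝓝[O] y, dist (v s y') (v s y) < ε / 4 :=
    Metric.tendsto_nhds.1 ((hv s hsT).continuousWithinAt hy) _ (by positivity)
  obtain ⟨U, hU, hUb⟩ : ∃ U ∈ 𝓝 y, ∀ y' ∈ U ∩ O, dist (v s y') (v s y) < ε / 4 := by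
    obtain ⟨U, hU, hUO⟩ := mem_nhdsWithin_iff_exists_mem_nhds_inter.1 hsc
    exact ⟨U, hU, fun y' hy' => hUO hy'⟩
  have hN : V ×ˢ U ∈ 𝓝 (τ, y) := prod_mem_nhds (hVo.mem_nhds hτV) hU
  refine mem_nhdsWithin_iff_exists_mem_nhds_inter.2 ⟨V ×ˢ U, hN, ?_⟩
  rintro ⟨τ', y'⟩ ⟨⟨hτ'V, hy'U⟩, hτ'I, hy'O⟩
  simp only [mem_setOf_eq]
  have h1 := hVb τ' ⟨hτ'V, hτ'I⟩ s ⟨hsV, hsT⟩ y' hy'O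
  have h2 := hUb y' ⟨hy'U, hy'O⟩
  have h3 := hVb τ ⟨hτV, hτ⟩ s ⟨hsV, hsT⟩ y hy
  rw [dist_eq_norm] at h2 ⊢
  calc ‖W (τ', y') - W (τ, y)‖
      = ‖(W (τ', y') - v s y') + (v s y' - v s y) - (W (τ, y) - v s y)‖ := by abel_nf
    _ ≤ ‖W (τ', y') - v s y'‖ + ‖v s y' - v s y‖ + ‖W (τ, y) - v s y‖ := by
        refine (norm_sub_le _ _).trans (add_le_add (norm_add_le _ _) le_rfl)
    _ < ε := by linarith

omit [TopologicalSpace X] [CompleteSpace F] in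
/-- **Uniformly Cauchy from a modulus.** If `‖v t y - v s y‖ ≤ ω n + A n |P t - P s|` for all
`n`, all `t, s ∈ T` and `y ∈ O`, with `ω n → 0` and `P` continuous at the points of `I`, then the
slices are uniformly Cauchy near every `τ ∈ I` in the sense of
`exists_continuousOn_of_uniformly_cauchy_slices`. [folklore] -/
theorem uniformly_cauchy_of_modulus {I T : Set ℝ} {O : Set X} {v : ℝ → X → F} {P : ℝ → ℝ}
    (hP : ∀ τ ∈ I, ContinuousAt P τ) {ω A : ℕ → ℝ} (hω : Tendsto ω atTop (𝓝 0))
    (hkey : ∀ n, ∀ t ∈ T, ∀ s ∈ T, ∀ y ∈ O, ‖v t y - v s y‖ ≤ ω n + A n * |P t - P s|) :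
    ∀ τ ∈ I, ∀ ε > (0 : ℝ), ∃ V ∈ 𝓝 τ, ∀ t ∈ V ∩ T, ∀ s ∈ V ∩ T, ∀ y ∈ O,
      ‖v t y - v s y‖ < ε := by
  intro τ hτ ε hε
  obtain ⟨n, hn⟩ : ∃ n, |ω n| < ε / 2 :=
    ((Metric.tendsto_nhds.1 hω) (ε / 2) (by positivity)).exists.imp fun n h => by
      simpa [Real.dist_eq] using h
  set a : ℝ := |A n| + 1 with ha
  have ha0 : 0 < a := by positivity
  have hPτ : ∀ᶠ t in 𝓝 τ, |P t - P τ| < ε / (4 * a) :=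
    (Metric.tendsto_nhds.1 (hP τ hτ)) _ (by positivity)
  refine ⟨{t | |P t - P τ| < ε / (4 * a)}, hPτ, fun t ht s hs y hy => ?_⟩
  have hts : |P t - P s| < ε / (2 * a) := by
    have h1 : |P t - P τ| < ε / (4 * a) := ht.1
    have h2 : |P s - P τ| < ε / (4 * a) := hs.1
    calc |P t - P s| = |(P t - P τ) - (P s - P τ)| := by ring_nf
      _ ≤ |P t - P τ| + |P s - P τ| := abs_sub _ _
      _ < ε / (4 * a) + ε / (4 * a) := add_lt_add h1 h2
      _ = ε / (2 * a) := by ring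
  have hAn : A n * |P t - P s| ≤ ε / 2 := by
    have h1 : A n * |P t - P s| ≤ |A n| * |P t - P s| :=
      mul_le_mul_of_nonneg_right (le_abs_self _) (abs_nonneg _)
    have h2 : |A n| * |P t - P s| ≤ |A n| * (ε / (2 * a)) :=
      mul_le_mul_of_nonneg_left hts.le (abs_nonneg _)
    have h3 : |A n| * (ε / (2 * a)) ≤ ε / 2 := by
      rw [show |A n| * (ε / (2 * a)) = ε / 2 * (|A n| / a) by ring]
      refine mul_le_of_le_one_right (by positivity) ?_
      rw [div_le_one ha0, ha]
      linarith
    linarith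
  calc ‖v t y - v s y‖ ≤ ω n + A n * |P t - P s| := hkey n t ht.2 s hs.2 y hy
    _ < ε := by linarith [le_abs_self (ω n)]

end Limit

/-! ### Slice-wise a.e. equality on a product -/

/-- **Slice-wise a.e. equal, a.e.-strongly measurable functions on `I × O` are a.e. equal**
(`I ⊆ ℝ`, `O` in a measure space `Y` with s-finite volume). (Pass to strongly measurable
modifications, whose coincidence set is measurable, and use Tonelli in the form
`Measure.ae_prod_iff_ae_ae`.) [folklore] -/
theorem ae_eq_restrict_prod_of_ae_ae {Y : Type*} [MeasureSpace Y] [SFinite (volume : Measure Y)]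
    {F' : Type*} [NormedAddCommGroup F'] {I : Set ℝ} {O : Set Y}
    {f g : ℝ × Y → F'} (hf : AEStronglyMeasurable f (volume.restrict (I ×ˢ O)))
    (hg : AEStronglyMeasurable g (volume.restrict (I ×ˢ O)))
    (h : ∀ᵐ t ∂(volume.restrict I), ∀ᵐ y ∂(volume.restrict O), f (t, y) = g (t, y)) :
    f =ᵐ[volume.restrict (I ×ˢ O)] g := by
  have hμ : (volume : Measure (ℝ × Y)).restrict (I ×ˢ O) =
      ((volume : Measure ℝ).restrict I).prod ((volume : Measure Y).restrict O) := by
    rw [Measure.volume_eq_prod, Measure.prod_restrict]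
  rw [hμ] at hf hg ⊢
  have h1 : ∀ᵐ t ∂(volume.restrict I), ∀ᵐ y ∂(volume.restrict O), f (t, y) = hf.mk f (t, y) :=
    Measure.ae_ae_of_ae_prod hf.ae_eq_mk
  have h2 : ∀ᵐ t ∂(volume.restrict I), ∀ᵐ y ∂(volume.restrict O), g (t, y) = hg.mk g (t, y) :=
    Measure.ae_ae_of_ae_prod hg.ae_eq_mk
  have hE : MeasurableSet {q : ℝ × Y | hf.mk f q = hg.mk g q} :=
    hf.stronglyMeasurable_mk.measurableSet_eq_fun hg.stronglyMeasurable_mk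
  have h3 : ∀ᵐ q ∂(((volume : Measure ℝ).restrict I).prod ((volume : Measure Y).restrict O)),
      hf.mk f q = hg.mk g q := by
    rw [Measure.ae_prod_iff_ae_ae hE]
    filter_upwards [h, h1, h2] with t ht h1t h2t
    filter_upwards [ht, h1t, h2t] with y hy h1y h2y
    rw [← h1y, ← h2y, hy]
  exact (hf.ae_eq_mk.trans h3).trans hg.ae_eq_mk.symm

end Literature.Analysis.FluidPDE
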